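import Mathlib.Combinatorics.SimpleGraph.Dart
import Mathlib.Analysis.SpecialFunctions.Complex.Arg
import Mathlib.Analysis.SpecialFunctions.Trigonometric.Basic
import Mathlib.Data.Set.Card
import Literature.Probability.LatticeModels.LatticeGraph
import HarnessLib

-- provenance: harness21/H21/H21/Prelude/StatMech/IsoradialGraphs.lean @ 9c1e647 (interim HEAD d8f2665); M5 mechanical rewrite
/-!
# Isoradial (rhombic) embeddings, train tracks and the square-grid property

Trunk: StatMech (prelude item P23 `IsoradialGraphs`, notion `isoradial_graph_percolation`,
part 1: geometry only; percolation on isoradial graphs is part 2).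

An *isoradial* embedding of a planar graph `G` is one in which every face is inscribed in a
circle of radius `1` whose centre lies inside the face. Equivalently (Duffin; Kenyon–Schlenker
2005) the *diamond graph* — vertices of `G` together with the circumcentres, a vertex joined to
the centres of its incident faces — is a *rhombic tiling*: every edge `e = xy` of `G` with its two
adjacent face centres `f, g` spans a rhombus `x f y g` of unit side. We record exactly this data:

* `RhombicEmbedding G F`: positions `z : V → ℂ` of vertices, `c : F → ℂ` of face centres, and
  the faces `leftFace d`, `rightFace d` to the left/right of each dart `d` (the face type `F` is a
  parameter). `RhombicEmbedding.IsIsoradial` is the (real) predicate that every edge spans a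
  non-degenerate rhombus with unit sides; `halfAngle d` (half of the rhombus angle at the
  vertex `d.fst`, in `(0, π/2)`), `HasBoundedAngles ε` (the bounded-angles property, stated as
  `halfAngle ∈ [ε, π/2 - ε]`; see the docstring of `halfAngle` for the conversion to the
  rhombus angle at the face centre, `π - 2 * halfAngle`, used by Grimmett–Manolescu).
* `squareLatticeEmbedding`: the standard embedding of `ℤ²` scaled by `√2` (faces = squares of
  side `√2` and unit circumradius, indexed by their lower-left lattice corner),
  `isIsoradial_squareLatticeEmbedding`; its train tracks are the two *diagonal* families
  `squareAntidiagTrack`, `squareDiagTrack`.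
* Train tracks (de Bruijn 1981; Kenyon–Schlenker 2005; Grimmett–Manolescu 2014, §2): the four
  *sides* of the rhombus of an edge are the corner–centre pairs
  `(x,f), (y,f), (y,g), (x,g) : V × F`;
  a *track* is a bi-infinite chain of rhombi, consecutive ones sharing a side, each rhombus being
  crossed between opposite sides (`RhombicEmbedding.IsTrack`, `IsSimpleTrack`, `trackMeets`,
  `trackBetween`).
* `RhombicEmbedding.HasSquareGridProperty`: a transcription of Grimmett–Manolescu's *square grid
  property* (see the docstring for the clauses and which are "H21 renderings"; it is strictly
  weaker than the printed SGP(I) of GM §4.2, whose faithful rendering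
  `RhombicEmbedding.SquareGridPropertyGM` / `HasSquareGridPropertyGM` lives in the sibling file
  `IsoradialSquareGrid` together with the implication to this one).

Design choices.
* **Reference orientation.** `sides e` and `oppositeSide e` are attached to an *unoriented* edge
  `e : G.edgeSet` but computed from the dart data; we fix an arbitrary reference dart
  `refDart e` over `e` (via `Quot.out`). Under `IsIsoradial` (clause `leftFace d.symm =
  rightFace d`) the result is independent of the orientation (`dartSides_symm`).
* `halfAngle` uses `Complex.arg` and `‖·‖` on `ℂ` (there is no `Complex.abs`).
* **Angle convention.** H21 fixes `θ := halfAngle d ∈ (0, π/2)`, half of the rhombus angle at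
  the vertex. The rhombus angle at the face centre (the angle subtended by the edge at either
  circumcentre) is `π - 2θ ∈ (0, π)`. Convention-free anchor for the dependent item
  (critical weights): the isoradial critical probability satisfies
  `p_e / (1 - p_e) = sin (2θ/3) / sin ((π - 2θ)/3)` (`ℤ²`: `θ = π/4`, `p = 1/2`; triangular:
  `θ = π/6`, `p = 2 sin (π/18)`; hexagonal: `θ = π/3`, `p = 1 - 2 sin (π/18)`).
* **No planarity axiom.** `IsIsoradial` only constrains each rhombus individually; that the
  rhombi tile the plane is not imposed in v0 (the statements consume only these clauses).
* Cardinalities of index sets are measured with `Set.encard` (`ℕ∞`), so "`≤ M`" also forces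
  finiteness (no `ncard = 0` junk).

Mathlib has no isoradial/rhombic embeddings, train tracks or planar-embedding faces
(searched: `isoradial`, `rhombic`, `Isoradial`); anchors used: `SimpleGraph.Dart`, `Dart.symm`,
`Dart.edge`, `Complex.arg`, `Set.encard`, and `Literature.Probability.LatticeModels.zdGraph`, `Site.toComplex`.

References: G. R. Grimmett, I. Manolescu, *Bond percolation on isoradial graphs: criticality and
universality*, PTRF 159 (2014), §§1–2 and §4; R. Kenyon, J.-M. Schlenker, *Rhombic embeddings
of planar quad-graphs*, Trans. AMS 357 (2005); N. G. de Bruijn, *Algebraic theory of Penrose's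
non-periodic tilings of the plane*, Indag. Math. 43 (1981).
-/

namespace Literature.Probability.LatticeModels

open Complex

/-! ### Rhombic embeddings -/

/-- The data of a rhombic (diamond-graph) embedding of a simple graph `G` with face type `F`:
vertex positions `z`, face-centre positions `c`, and for every dart `d = (x → y)` the faces
`leftFace d` / `rightFace d` lying to its left / right. No axioms are imposed here; see
`RhombicEmbedding.IsIsoradial`. (Kenyon–Schlenker 2005, §1; Grimmett–Manolescu 2014, §2.1.) [cite: KenyonSchlenker2005, §1] -/
structure RhombicEmbedding {V : Type*} (G : SimpleGraph V) (F : Type*) where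
  /-- Position of a vertex in the complex plane. -/
  z : V → ℂ
  /-- Position of (the circumcentre of) a face. -/
  c : F → ℂ
  /-- The face to the left of a dart. -/
  leftFace : G.Dart → F
  /-- The face to the right of a dart. -/
  rightFace : G.Dart → F

namespace RhombicEmbedding

variable {V : Type*} {G : SimpleGraph V} {F : Type*} (emb : RhombicEmbedding G F)

/-- An embedding is *isoradial* if every edge spans a non-degenerate unit rhombus: for every
dart `d = (x → y)`, both endpoints are at distance `1` from the centre of the left face (hence,
via `d.symm`, also from the right face), the left face of the reversed dart is the right face of
`d`, the two adjacent face centres are distinct (non-degenerate rhombus), and distinct vertices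
have distinct positions. The global condition that these rhombi tile the plane (planarity of the
diamond graph) is *not* imposed in v0. (Kenyon–Schlenker 2005, §1; Grimmett–Manolescu 2014,
§2.1: "each face is inscribable in a circle of radius 1 whose centre lies in the face".) [cite: KenyonSchlenker2005, §1] -/
structure IsIsoradial : Prop where
  /-- Unit corner–centre distances. -/
  norm_sub_eq_one : ∀ d : G.Dart,
    ‖emb.z d.fst - emb.c (emb.leftFace d)‖ = 1 ∧
      ‖emb.z d.snd - emb.c (emb.leftFace d)‖ = 1
  /-- Reversing a dart swaps left and right. -/
  leftFace_symm : ∀ d : G.Dart, emb.leftFace d.symm = emb.rightFace d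
  /-- Rhombi are non-degenerate. -/
  c_leftFace_ne : ∀ d : G.Dart, emb.c (emb.leftFace d) ≠ emb.c (emb.rightFace d)
  /-- The vertex embedding is injective. -/
  z_injective : Function.Injective emb.z

/-- The rhombus *half-angle* `θ = halfAngle d ∈ (0, π/2)` of the edge underlying the dart
`d = (x → y)`: the (unsigned) angle at the vertex `x` between the diagonal `xy` and the side
from `x` to the left face centre `f`, i.e. half of the rhombus angle at `x`.

**Angle convention (H21).** The rhombus `x f y g` has angle `2θ` at the vertices `x, y` and
angle `π - 2θ` at the face centres `f, g` (the angle subtended by the edge at either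
circumcentre; the edge has length `2 cos θ = 2 sin ((π - 2θ)/2)`). Grimmett–Manolescu's
parameter `θ_e` is a rhombus angle of `e`; whichever of the two printed conventions is used,
it is an affine function of `halfAngle` (`2θ` or `π - 2θ`), and the dependent item
`criticalWeight` must be transcribed through the convention-free identity
`p_e / (1 - p_e) = sin (2θ/3) / sin ((π - 2θ)/3)`, `θ = halfAngle` (checked on `ℤ²`,
triangular and hexagonal lattices, see the module docstring).
(Kenyon 2002, §1; Grimmett–Manolescu 2014, §2.1 and (1.3)/(2.1); H21 rendering.) [cite: Kenyon2002, §1] -/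
noncomputable def halfAngle (d : G.Dart) : ℝ :=
  |Complex.arg ((emb.c (emb.leftFace d) - emb.z d.fst) / (emb.z d.snd - emb.z d.fst))|

/-- The *bounded-angles property* BAP(ε), H21 rendering: every rhombus half-angle
`halfAngle d` lies in `[ε, π/2 - ε]`; equivalently every rhombus angle (at a vertex, `2θ`, or
at a face centre, `π - 2θ`) lies in `[2ε, π - 2ε]`. Grimmett–Manolescu state BAP for the
rhombus angle `θ_e` with some `ε > 0`; the family of properties `∃ ε > 0, HasBoundedAngles ε`
is the same under either convention (rescale `ε`). (Grimmett–Manolescu 2014, §1 and (2.1),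
bounded-angles property; H21 rendering in terms of `halfAngle`.) [cite: GrimmettManolescu2014, §1 and (2.1] -/
def HasBoundedAngles (ε : ℝ) : Prop :=
  ∀ d : G.Dart, ε ≤ emb.halfAngle d ∧ emb.halfAngle d ≤ Real.pi / 2 - ε

end RhombicEmbedding

/-! ### The square lattice -/

/-- The face of `ℤ²` to the left of the dart `x → y`, faces (lattice squares) being indexed by
their lower-left lattice corner: east step `y = x + e₀` ↦ `x`; north step `y = x + e₁` ↦
`x - e₀`; west step `x = y + e₀` ↦ `y - e₁`; south step `x = y + e₁` ↦ `y`. (For non-adjacent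
`x, y` the last branch is a junk value.)
(Grimmett–Manolescu 2014, §2.1, the square lattice as an isoradial graph.) [cite: GrimmettManolescu2014, §2.1  the square lattice as an isoradial] -/
def squareLeftFace (x y : Site 2) : Site 2 :=
  if y = x + Pi.single 0 1 then x
  else if y = x + Pi.single 1 1 then x - Pi.single 0 1
  else if x = y + Pi.single 0 1 then y - Pi.single 1 1
  else y

/-- The standard isoradial embedding of the square lattice `ℤ²`, scaled by `√2` so that the
circumradius is `1`: the vertex `x` sits at `√2 (x₀ + i x₁)`, the face with lower-left lattice
corner `x` (a square of side `√2`, unit circumradius) is centred at `√2 (x + (1 + i)/2)`, left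
faces are given by `squareLeftFace` and `rightFace d := leftFace d.symm` (definitionally).
(Grimmett–Manolescu 2014, §2.1.) [cite: GrimmettManolescu2014, §2.1] -/
noncomputable def squareLatticeEmbedding : RhombicEmbedding (zdGraph 2) (Site 2) where
  z x := Real.sqrt 2 * Site.toComplex x
  c x := Real.sqrt 2 * (Site.toComplex x + (1 + Complex.I) / 2)
  leftFace d := squareLeftFace d.fst d.snd
  rightFace d := squareLeftFace d.snd d.fst

/-- The square-lattice embedding (scaled by `√2` so that corner–centre distances are `1`) is
isoradial; all its half-angles equal `π/4`. (Grimmett–Manolescu 2014, §2.1.) [cite: GrimmettManolescu2014, §2.1] -/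
def isIsoradial_squareLatticeEmbedding : Prop :=
  squareLatticeEmbedding.IsIsoradial

/-- Every half-angle of the square lattice is `π/4`, so it has BAP(ε) for all `ε ≤ π/4`.
(Grimmett–Manolescu 2014, §2.1.) [cite: GrimmettManolescu2014, §2.1] -/
def hasBoundedAngles_squareLatticeEmbedding : Prop :=
  ∀ {ε : ℝ} (hε : ε ≤ Real.pi / 4),
    squareLatticeEmbedding.HasBoundedAngles ε

/-! ### Rhombi, their sides, and train tracks -/

namespace RhombicEmbedding

variable {V : Type*} {G : SimpleGraph V} {F : Type*} (emb : RhombicEmbedding G F)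

/-- An arbitrary but fixed reference orientation of the edge `e` (a dart over `e`, obtained by
`Quot.out`). Only used to read off the two faces of `e`; under `IsIsoradial` nothing depends on
the choice (`dartSides_symm`). (Grimmett–Manolescu 2014, §2.1: edges are unoriented.) [cite: GrimmettManolescu2014, §2.1: edges are unoriented] -/
noncomputable def refDart (e : G.edgeSet) : G.Dart :=
  ⟨(e : Sym2 V).out, by
    have h : Sym2.mk (e : Sym2 V).out.1 (e : Sym2 V).out.2 ∈ G.edgeSet := by
      rw [Sym2.mk, Quot.out_eq]; exact e.2
    exact h⟩

/-- The reference dart of `e` lies over `e`. (Bookkeeping; Grimmett–Manolescu 2014, §2.1.) [cite: GrimmettManolescu2014, §2.1] -/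
@[simp] theorem refDart_edge (e : G.edgeSet) : (refDart e).edge = (e : Sym2 V) := by
  change Sym2.mk (e : Sym2 V).out.1 (e : Sym2 V).out.2 = _
  rw [Sym2.mk, Quot.out_eq]

/-- The four sides of the rhombus of the dart `d = (x → y)` with left face `f` and right face
`g`, encoded as corner–centre pairs: `{(x,f), (y,f), (y,g), (x,g)}`.
(de Bruijn 1981; Grimmett–Manolescu 2014, §2.1, the diamond graph `G^◇`.) [cite: Bruijn1981] -/
def dartSides [DecidableEq V] [DecidableEq F] (d : G.Dart) : Finset (V × F) :=
  {(d.fst, emb.leftFace d), (d.snd, emb.leftFace d), (d.snd, emb.rightFace d),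
    (d.fst, emb.rightFace d)}

/-- In the rhombus of the dart `d = (x → y)` (left face `f`, right face `g`), the side opposite
to a given side: `(x,f) ↔ (y,g)` and `(y,f) ↔ (x,g)`; the identity on pairs that are not sides
of this rhombus. (de Bruijn 1981; Grimmett–Manolescu 2014, §2.1: a track crosses each rhombus
from a side to the opposite side.) [cite: Bruijn1981] -/
def dartOppositeSide [DecidableEq V] [DecidableEq F] (d : G.Dart) (p : V × F) : V × F :=
  if p = (d.fst, emb.leftFace d) then (d.snd, emb.rightFace d)
  else if p = (d.snd, emb.rightFace d) then (d.fst, emb.leftFace d)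
  else if p = (d.snd, emb.leftFace d) then (d.fst, emb.rightFace d)
  else if p = (d.fst, emb.rightFace d) then (d.snd, emb.leftFace d)
  else p

/-- The four sides (corner–centre pairs) of the rhombus of the edge `e = s(x,y)` with faces
`f, g`: `{(x,f), (y,f), (y,g), (x,g)}`, read off from the reference dart `refDart e`.
(de Bruijn 1981; Grimmett–Manolescu 2014, §2.1.) [cite: Bruijn1981] -/
noncomputable def sides [DecidableEq V] [DecidableEq F] (e : G.edgeSet) : Finset (V × F) :=
  emb.dartSides (refDart e)

/-- The opposite-side map of the rhombus of the edge `e = s(x,y)` with faces `f, g`: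
`(x,f) ↦ (y,g)`, `(y,f) ↦ (x,g)` and back, the identity off `emb.sides e`.
(de Bruijn 1981; Grimmett–Manolescu 2014, §2.1.) [cite: Bruijn1981] -/
noncomputable def oppositeSide [DecidableEq V] [DecidableEq F] (e : G.edgeSet) :
    V × F → V × F :=
  emb.dartOppositeSide (refDart e)

section

variable [DecidableEq V] [DecidableEq F]

/-- Under isoradiality the side set of a rhombus does not depend on the orientation of the dart.
(Grimmett–Manolescu 2014, §2.1.) [cite: GrimmettManolescu2014, §2.1] -/
theorem dartSides_symm (h : emb.IsIsoradial) (d : G.Dart) :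
    emb.dartSides d.symm = emb.dartSides d := by
  have h1 := h.leftFace_symm d
  have h2 := h.leftFace_symm d.symm
  rw [SimpleGraph.Dart.symm_symm] at h2
  ext p
  simp only [dartSides, Finset.mem_insert, Finset.mem_singleton, SimpleGraph.Dart.symm_toProd,
    Prod.fst_swap, Prod.snd_swap, h1, ← h2]
  tauto

/-- Under isoradiality the opposite-side map does not depend on the orientation of the dart.
(Grimmett–Manolescu 2014, §2.1.) [cite: GrimmettManolescu2014, §2.1] -/
theorem dartOppositeSide_symm (h : emb.IsIsoradial) (d : G.Dart) :
    emb.dartOppositeSide d.symm = emb.dartOppositeSide d := by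
  have h1 := h.leftFace_symm d
  have h2 := h.leftFace_symm d.symm
  rw [SimpleGraph.Dart.symm_symm] at h2
  funext p
  simp only [dartOppositeSide, SimpleGraph.Dart.symm_toProd, Prod.fst_swap, Prod.snd_swap, h1,
    ← h2]
  have := d.fst_ne_snd
  split_ifs <;> simp_all

/-- Under isoradiality, `emb.sides e` may be computed from any dart over `e`.
(Grimmett–Manolescu 2014, §2.1.) [cite: GrimmettManolescu2014, §2.1] -/
theorem sides_eq_dartSides (h : emb.IsIsoradial) {d : G.Dart} {e : G.edgeSet}
    (hd : d.edge = e) : emb.sides e = emb.dartSides d := by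
  unfold sides
  have h' : (refDart e).edge = d.edge := by rw [refDart_edge, hd]
  rcases (SimpleGraph.dart_edge_eq_iff _ _).1 h' with h'' | h''
  · rw [h'']
  · rw [h'', emb.dartSides_symm h]

/-- The opposite-side map is an involution. (de Bruijn 1981; Grimmett–Manolescu 2014, §2.1.) [cite: Bruijn1981] -/
theorem dartOppositeSide_dartOppositeSide (d : G.Dart) (p : V × F) :
    emb.dartOppositeSide d (emb.dartOppositeSide d p) = p := by
  have := d.fst_ne_snd
  unfold dartOppositeSide
  split_ifs <;> simp_all

/-- The opposite-side map of an edge is an involution.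
(de Bruijn 1981; Grimmett–Manolescu 2014, §2.1.) [cite: Bruijn1981] -/
theorem oppositeSide_oppositeSide (e : G.edgeSet) (p : V × F) :
    emb.oppositeSide e (emb.oppositeSide e p) = p :=
  emb.dartOppositeSide_dartOppositeSide (refDart e) p

/-- The opposite side of a side is a side. (de Bruijn 1981; Grimmett–Manolescu 2014, §2.1.) [cite: Bruijn1981] -/
theorem oppositeSide_mem_sides {e : G.edgeSet} {p : V × F} (hp : p ∈ emb.sides e) :
    emb.oppositeSide e p ∈ emb.sides e := by
  simp only [sides, dartSides, Finset.mem_insert, Finset.mem_singleton] at hp ⊢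
  unfold oppositeSide dartOppositeSide
  split_ifs <;> simp_all

/-- Off the sides of `e`, `oppositeSide e` is the identity.
(de Bruijn 1981; Grimmett–Manolescu 2014, §2.1.) [cite: Bruijn1981] -/
theorem oppositeSide_of_not_mem {e : G.edgeSet} {p : V × F} (hp : p ∉ emb.sides e) :
    emb.oppositeSide e p = p := by
  simp only [sides, dartSides, Finset.mem_insert, Finset.mem_singleton, not_or] at hp
  unfold oppositeSide dartOppositeSide
  simp [hp]

/-- A *(train) track*: a bi-infinite sequence of rhombi `r n` together with sides `s n` such that
`s n` is a common side of the distinct rhombi `r n` and `r (n+1)`, and each rhombus `r n` is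
entered through `s (n-1)` and left through the opposite side `s n`.
(de Bruijn 1981, "ribbons"; Kenyon–Schlenker 2005, §1; Grimmett–Manolescu 2014, §2.1: "a track
is a doubly infinite sequence of rhombi, each sharing a side with the next, such that the shared
sides of any rhombus are opposite".) [cite: Bruijn1981, "ribbons"] -/
def IsTrack (r : ℤ → G.edgeSet) : Prop :=
  ∃ s : ℤ → V × F, ∀ n : ℤ, s n ∈ emb.sides (r n) ∧ s n ∈ emb.sides (r (n + 1)) ∧
    r n ≠ r (n + 1) ∧ s n = emb.oppositeSide (r n) (s (n - 1))

/-- A *simple* (non-self-intersecting) track: a track visiting each rhombus at most once.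
(Grimmett–Manolescu 2014, §2.1; Kenyon–Schlenker 2005, Thm 3.1: in a rhombic embedding no
track crosses itself.) [cite: GrimmettManolescu2014, §2.1] -/
def IsSimpleTrack (r : ℤ → G.edgeSet) : Prop :=
  emb.IsTrack r ∧ Function.Injective r

end

end RhombicEmbedding

section Tracks

variable {V : Type*} {G : SimpleGraph V}

/-- Two tracks *meet* (intersect) if they share a rhombus. (Grimmett–Manolescu 2014, §2.1:
"two tracks intersect if they have a common rhombus".) [cite: GrimmettManolescu2014, §2.1: "two tracks intersect if they have] -/
def trackMeets (r r' : ℤ → G.edgeSet) : Prop :=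
  ∃ m n, r m = r' n

/-- The indices at which the track `r` meets the track `r'`.
(Grimmett–Manolescu 2014, §2.1.) [cite: GrimmettManolescu2014, §2.1] -/
def meetIndices (r r' : ℤ → G.edgeSet) : Set ℤ :=
  {m | ∃ n, r m = r' n}

/-- The indices of the track `r` lying *strictly between* a meeting with `r₁` and a meeting with
`r₂` (in either order along `r`). When `r` meets each of `r₁, r₂` exactly once — the case of
distinct simple tracks of a rhombic tiling, which meet at most once (Kenyon–Schlenker 2005,
Thm 3.1; Grimmett–Manolescu 2014, §2.1) — this is the open segment of `r` between them; if
`r` meets `r₁` or `r₂` at several indices it is the union of the open segments over all pairs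
of meeting indices (so a bound on its size is only stronger).
(Grimmett–Manolescu 2014, §2.3–2.4; H21 rendering.) [cite: KenyonSchlenker2005, Thm 3.1] -/
def trackBetween (r r₁ r₂ : ℤ → G.edgeSet) : Set ℤ :=
  {n | ∃ m ∈ meetIndices r r₁, ∃ m' ∈ meetIndices r r₂,
    (m < n ∧ n < m') ∨ (m' < n ∧ n < m)}

/-- `trackMeets` in terms of `meetIndices`. (Bookkeeping; Grimmett–Manolescu 2014, §2.1.) [cite: GrimmettManolescu2014, §2.1] -/
theorem trackMeets_iff_nonempty (r r' : ℤ → G.edgeSet) :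
    trackMeets r r' ↔ (meetIndices r r').Nonempty :=
  Iff.rfl

/-- Meeting is symmetric. (Grimmett–Manolescu 2014, §2.1.) [cite: GrimmettManolescu2014, §2.1] -/
theorem trackMeets_comm (r r' : ℤ → G.edgeSet) : trackMeets r r' ↔ trackMeets r' r := by
  constructor <;> rintro ⟨m, n, h⟩ <;> exact ⟨n, m, h.symm⟩

end Tracks

/-! ### The square-grid property -/

namespace RhombicEmbedding

variable {V : Type*} {G : SimpleGraph V} {F : Type*} (emb : RhombicEmbedding G F)

/-- The *square-grid property* (SGP) of Grimmett–Manolescu, transcribed. In GM 2014 (§2.3–2.4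
and the paragraph before Thm 1.1) a pair of families of tracks `(s_k : k ∈ ℤ)`, `(t_k : k ∈ ℤ)`
of an isoradial graph is a *square grid* when: the tracks of each family are pairwise
non-intersecting; every `s_i` intersects every `t_j`; and each family is indexed in order, `s_j`
lying between `s_i` and `s_k` whenever `i < j < k` (similarly for `t`). The graph has the SGP if
it possesses a square grid whose intersections are boundedly separated: the number of rhombi
on `s_i` between its intersections with `t_j` and `t_{j+1}` (and on `t_i` between `s_j` and
`s_{j+1}`) is bounded uniformly in `i, j`. (This paraphrase follows the architect's outline of
GM's definition. **Outcome of the clause-by-clause check against the printed text** (GM, PTRF 159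
(2014) = arXiv:1204.0505, §4.2, definition of SGP(I)): this rendering is *strictly weaker* than
the printed property — it drops, from GM's clause (b), that *every* track of the graph outside a
grid family crosses *all* tracks of that family, in index order, and it replaces the parameter
`I` of SGP(I) by `∃ M`. The faithful version is `RhombicEmbedding.SquareGridPropertyGM I` /
`RhombicEmbedding.HasSquareGridPropertyGM` in `Literature.Probability.LatticeModels.IsoradialSquareGrid`,
where `HasSquareGridPropertyGM.hasSquareGridProperty` proves that it implies the present one and
the module docstring gives a rhombic tiling separating the two. Statements citing GM's theorems
should hypothesise the faithful version. This is a *predicate* on the embedding — `emb` is an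
explicit argument — not a named fact.) The clauses below are, in order:
1. every `s k` and every `t k` is a simple track;
2. distinct `s`-tracks do not meet, distinct `t`-tracks do not meet;
3. every `s i` meets every `t j`;
4. *betweenness* — "H21 rendering" of "indexed in order / `s_j` lies between `s_i` and `s_k`":
   for `i < j < k`, every track meeting `s i` and `s k` meets `s j` (same for `t`);
5. *bounded separation* — "H21 rendering" via `trackBetween` and `Set.encard` (so the bound
   also asserts finiteness): `∃ M, ∀ i j, encard (trackBetween (s i) (t j) (t (j+1))) ≤ M` and
   symmetrically for `t i` between `s j`, `s (j+1)`.
(Grimmett–Manolescu, PTRF 159 (2014), §4.2; H21 rendering, weaker than printed.) [cite: GM2014, §4.2 (H21 rendering; weaker than the printed SGP(I))] -/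
def HasSquareGridProperty (emb : RhombicEmbedding G F) [DecidableEq V] [DecidableEq F] : Prop :=
  ∃ s t : ℤ → ℤ → G.edgeSet,
    (∀ k, emb.IsSimpleTrack (s k)) ∧ (∀ k, emb.IsSimpleTrack (t k)) ∧
    (Pairwise fun i j => ¬ trackMeets (s i) (s j)) ∧
    (Pairwise fun i j => ¬ trackMeets (t i) (t j)) ∧
    (∀ i j, trackMeets (s i) (t j)) ∧
    (∀ i j k, i < j → j < k → ∀ r, emb.IsTrack r →
      trackMeets r (s i) → trackMeets r (s k) → trackMeets r (s j)) ∧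
    (∀ i j k, i < j → j < k → ∀ r, emb.IsTrack r →
      trackMeets r (t i) → trackMeets r (t k) → trackMeets r (t j)) ∧
    ∃ M : ℕ, (∀ i j, (trackBetween (s i) (t j) (t (j + 1))).encard ≤ M) ∧
      (∀ i j, (trackBetween (t i) (s j) (s (j + 1))).encard ≤ M)

end RhombicEmbedding

/-- The horizontal edge `{(a, k), (a+1, k)}` of `ℤ²`, as an element of the edge set.
(Grimmett–Manolescu 2014, §2.1, the square lattice.) [cite: GrimmettManolescu2014, §2.1  the square lattice] -/
def squareHorizEdge (a k : ℤ) : (zdGraph 2).edgeSet :=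
  ⟨s(![a, k], ![a + 1, k]), by
    rw [SimpleGraph.mem_edgeSet, zdGraph_adj_iff]
    refine ⟨0, Or.inl ?_⟩
    ext i; fin_cases i <;> simp⟩

/-- The vertical edge `{(k, a), (k, a+1)}` of `ℤ²`, as an element of the edge set.
(Grimmett–Manolescu 2014, §2.1, the square lattice.) [cite: GrimmettManolescu2014, §2.1  the square lattice] -/
def squareVertEdge (k a : ℤ) : (zdGraph 2).edgeSet :=
  ⟨s(![k, a], ![k, a + 1]), by
    rw [SimpleGraph.mem_edgeSet, zdGraph_adj_iff]
    refine ⟨1, Or.inl ?_⟩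
    ext i; fin_cases i <;> simp⟩

/-- The `k`-th *antidiagonal* train track of the square lattice: it alternates the horizontal
edge `{(k-m, m), (k-m+1, m)}` (index `2m`) and the vertical edge `{(k-m, m), (k-m, m+1)}` (index
`2m+1`), running north-west along the antidiagonal `x₀ + x₁ = k` (`n / 2` is floor division).
Side chain (with `squareLeftFace`): the horizontal rhombus `h(a,m)` has faces `f = (a,m)`
(above), `g = (a,m-1)` (below); the vertical rhombus `v(a,m)` has faces `(a-1,m)` (left),
`(a,m)` (right); `h(a,m)` and `v(a,m)` share the side `((a,m),(a,m))`, whose opposite in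
`v(a,m)` is `((a,m+1),(a-1,m))`, a side of `h(a-1,m+1)`, whose opposite there is
`((a-1,m+1),(a-1,m+1))`, and so on. (de Bruijn 1981; Grimmett–Manolescu 2014, §2.1 and §2.4:
the tracks of `ℤ²` are its diagonals.) [cite: Bruijn1981] -/
def squareAntidiagTrack (k : ℤ) (n : ℤ) : (zdGraph 2).edgeSet :=
  if n % 2 = 0 then squareHorizEdge (k - n / 2) (n / 2) else squareVertEdge (k - n / 2) (n / 2)

/-- The `k`-th *diagonal* train track of the square lattice: it alternates the horizontal edge
`{(k+m, m), (k+m+1, m)}` (index `2m`) and the vertical edge `{(k+m+1, m), (k+m+1, m+1)}`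
(index `2m+1`), running north-east; its edges are exactly those joining the diagonals
`x₀ - x₁ = k` and `x₀ - x₁ = k + 1` (while the edges of `squareAntidiagTrack k` are exactly
those joining `x₀ + x₁ = k` and `x₀ + x₁ = k + 1`). Side chain: `h(a,m)` and `v(a+1,m)` share
the side `((a+1,m),(a,m))` (`(y,f)` of `h`, `(x,f)` of `v`), whose opposite in `v(a+1,m)` is
`((a+1,m+1),(a+1,m))`, a side (`(x,g)`) of `h(a+1,m+1)`, whose opposite there is
`((a+2,m+1),(a+1,m+1))`, and so on. (de Bruijn 1981; Grimmett–Manolescu 2014, §2.1, §2.4.) [cite: Bruijn1981] -/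
def squareDiagTrack (k : ℤ) (n : ℤ) : (zdGraph 2).edgeSet :=
  if n % 2 = 0 then squareHorizEdge (k + n / 2) (n / 2)
  else squareVertEdge (k + n / 2 + 1) (n / 2)

/-- The antidiagonals of `ℤ²` are simple tracks of `squareLatticeEmbedding` (side chain in the
docstring of `squareAntidiagTrack`; consecutive edges are horizontal/vertical hence distinct;
the corner `(k - n/2, n/2)` determines `n`, so the track is injective).
(Grimmett–Manolescu 2014, §2.1, §2.4.) [cite: GrimmettManolescu2014, §2.1  §2.4] -/
def isSimpleTrack_squareAntidiagTrack : Prop :=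
  ∀ (k : ℤ),
    squareLatticeEmbedding.IsSimpleTrack (squareAntidiagTrack k)

/-- The diagonals of `ℤ²` are simple tracks of `squareLatticeEmbedding` (side chain in the
docstring of `squareDiagTrack`). (Grimmett–Manolescu 2014, §2.1, §2.4.) [cite: GrimmettManolescu2014, §2.1  §2.4] -/
def isSimpleTrack_squareDiagTrack : Prop :=
  ∀ (k : ℤ),
    squareLatticeEmbedding.IsSimpleTrack (squareDiagTrack k)

/-- `ℤ²` has the square-grid property: take `s = squareAntidiagTrack` and
`t = squareDiagTrack`. Every rhombus (edge) of `ℤ²` lies on exactly one antidiagonal track and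
exactly one diagonal track, so tracks of the same family never meet and betweenness holds
by uniqueness; `s i` meets `t j` exactly once, at index `n = i - j` of both tracks (the
horizontal edge `h((i+j)/2, (i-j)/2)` if `i - j` is even, a vertical edge otherwise), so along
`s i` the meetings with `t j` and `t (j+1)` occur at consecutive indices and the separation
bound `M = 0` works (symmetrically for `t`). (Grimmett–Manolescu 2014, §1 and §2.4:
"the square lattice ... has the square grid property".) [cite: GrimmettManolescu2014, §1 and §2.4: "the square lattice ... has] -/
def hasSquareGridProperty_squareLattice : Prop :=
  squareLatticeEmbedding.HasSquareGridProperty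

end Literature.Probability.LatticeModels
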